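import Summits.BirchSwinnertonDyer.BirchSwinnertonDyer.Theorems.PrintCFramBottomClassIndexLawFiveLeHerbrandSelmerToHomField
import Summits.BirchSwinnertonDyer.BirchSwinnertonDyer.Theorems.PrintCFramBottomClassIndexLawFiveLeHerbrandUntwistHom
import HarnessLib

/-!
# Crux `PrintCFram.BottomClassIndexLawFiveLe` (stmt-BirchSwinnertonDyer-20372), line `eisenstein-resource-bdp-line` (v10 → v11):
# Stub H in HOM FORM over the splitting field — the LEAD's `N_θ`-cocycle statement ⟸ the character statement over the NUMBER FIELD `L`

Cell `bsd-print-cfram`, width seat `bsd-line-cfram-p1-w4` (generation g5), `--supports stmt-BirchSwinnertonDyer-20372` (helper);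
fifth file of the T2′ series (p648816, p649370, p651053, p652039). THEOREMS ONLY; no definition, no named fact, no `sorry`. BSD is not
proved by any of this; no summit statement is proved by this seat; no stub is closed.

WHY. LEAD g8's registry v11 replaces Stub H by its Hom form (`HerbrandUntwist.stubH_of_forall_hom_of_cmRamified`, p651343): for
`N = ker(Γ_K → Aut Φ)` every continuous cocycle `z : N → Φ` (a homomorphism, `N` acting trivially) which is `Γ_K`-invariant
(`g • z(g⁻¹ n g) = z(n)`), kills `N ⊓ I_v` (`inertiaIn N v`) for the finite `v ∉ S`, `v ∤ p`, and kills `N ⊓ D_𝔭` (`decompIn N 𝔭`), is `0`.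
This file proves that statement FROM the arithmetic one over the number field `L = K(Φ)` (any `L/K` with `res(Γ_L) = N`, p652039 §1):
«every continuous character `φ : Γ_L → ℤ/p`, `θ`-equivariant along `res`, killing the inertia groups `I_𝔔 ≤ Γ_L` of the primes `𝔔` of
`\bar ℤ_L` above the places of `L` over `v ∉ S` (`v ∤ p`) and the decomposition groups `D_𝔔` above the places over `𝔭`, is trivial» —
so that the T4 prover (Road A steps A3–A6, class field theory of `L`) closes the v11 stub directly.

* `apply_conj_eq_smul_of_invariant` — invariance `g • z(g⁻¹ n g) = z n` ⟹ equivariance `z(g n g⁻¹) = g • z(n)`.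
* `apply_eq_zero_of_conj_mem_inertia` / `apply_eq_zero_of_conj_mem_decomp` — an invariant `z` killing `N ⊓ I_v` (resp. `N ⊓ D_𝔭`) kills
  every `n ∈ N` with a conjugate in `I_v` (resp. `D_𝔭`); hence (`…_of_mem_primesAbove_inertia`, `…_decompositionSubgroup`) every `n ∈ N ∩ I_𝔓`,
  `n ∈ N ∩ D_𝔓` for ALL primes `𝔓` of `\bar ℤ_K` above `v` resp. `𝔭` (p651053's dictionary).
* **`forall_cocycle_ker_eq_zero_of_forall_hom_field`** — GENERIC (`K` number field, `M` of prime order `p`, character `θ` with `ker θ = N`,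
  `L` with `res(Γ_L) = N`): the LEAD's cocycle statement for `(N, M, S₀, 𝔭)` ⟸ the character statement over `L`.
* ON THE CLASS: **`homVanishing_sub_of_forall_hom_field`**, **`homVanishing_quot_of_forall_hom_field`** — the hypotheses `hS`, `hQ` of
  `HerbrandUntwist.stubH_of_forall_hom_of_cmRamified` (v11's Stub H) for `Φ.Sub`, `Φ.Quot`, from the two character statements over
  `L = K(Φ)`, `L' = K(W[p]/Φ)`; and **`stubH_of_forall_hom_field`**: Stub H's two v10 conclusions from them (via p651343).

References: Greenberg, LNM 1716 §3; Neukirch, *Algebraic Number Theory* I §9 (9.4)–(9.6), IV §1; Serre, *Galois Cohomology* I §2.3, §5.1;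
the LEAD g8 report §4 Road A (crux workfile).
-/

noncomputable section

-- summit-side namespace `Summit.BirchSwinnertonDyer.BirchSwinnertonDyer.…` (single-conjunct summit, D-0017 layout)
set_option linter.dupNamespace false
set_option autoImplicit false

open scoped Classical Pointwise
open NumberField WeierstrassCurve IsDedekindDomain Field
open Literature.NumberTheory.EllipticCurves
open Literature.NumberTheory.EllipticCurves.GreenbergSelmer
open Literature.NumberTheory.EllipticCurves.GreenbergVatsal2000
open Literature.NumberTheory.GaloisRepresentations
open Summit.BirchSwinnertonDyer.Rank1Residual
open Summit.BirchSwinnertonDyer.Rank1Residual.X11b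

namespace Summit.BirchSwinnertonDyer.BirchSwinnertonDyer.Theorems.PrintCFram.HerbrandSelmerToHom

/-! ## §1 Invariant homomorphisms on the kernel of the action -/

section Invariant

variable {K : Type} [Field K] [NumberField K]
variable {M : Type} [AddCommGroup M] [DistribMulAction (absoluteGaloisGroup K) M] [TopologicalSpace M] [DiscreteTopology M]
variable {N : Subgroup (absoluteGaloisGroup K)} [N.Normal]

omit [NumberField K] in
/-- **Invariance ⟹ equivariance.** If `g • z(g⁻¹ n g) = z(n)` for all `g ∈ Γ_K`, `n ∈ N` (the cocycle of a `Γ_K`-invariant class of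
`H¹(N, M)`), then `z(g n g⁻¹) = g • z(n)` (conjugate-membership proof supplied by normality). [cite: SerreGaloisCohomology1997, I §5.1] -/
theorem apply_conj_eq_smul_of_invariant (z : contOneCocycles (discreteTopRep N M))
    (hinv : ∀ (g : absoluteGaloisGroup K) (n : N), g • z.1 (subgroupConj N g n) = z.1 n)
    (g : absoluteGaloisGroup K) (n : N) :
    z.1 ⟨g * (n : absoluteGaloisGroup K) * g⁻¹, Subgroup.Normal.conj_mem inferInstance _ n.2 g⟩ = g • z.1 n := by
  have h := hinv g⁻¹ n
  have e : subgroupConj N g⁻¹ n = ⟨g * (n : absoluteGaloisGroup K) * g⁻¹, Subgroup.Normal.conj_mem inferInstance _ n.2 g⟩ :=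
    Subtype.ext (by rw [subgroupConj_apply_coe, inv_inv])
  rw [e] at h
  rw [← h, smul_inv_smul]

/-- An invariant `z` killing `N ⊓ I_v` (`inertiaIn N v`, the chosen place) kills every `n ∈ N` having a conjugate `σ n σ⁻¹ ∈ I_v`.
[cite: NeukirchANT1999, Ch. I §9 (9.4)] -/
theorem apply_eq_zero_of_conj_mem_inertia (z : contOneCocycles (discreteTopRep N M))
    (hinv : ∀ (g : absoluteGaloisGroup K) (n : N), g • z.1 (subgroupConj N g n) = z.1 n)
    {v : HeightOneSpectrum (𝓞 K)} (hunr : ∀ x : inertiaIn N v, z.1 (inertiaInToH N v x) = 0)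
    {σ : absoluteGaloisGroup K} (n : N) (hσ : σ * (n : absoluteGaloisGroup K) * σ⁻¹ ∈ inertia (K := K) v) : z.1 n = 0 := by
  have hN : σ * (n : absoluteGaloisGroup K) * σ⁻¹ ∈ N := Subgroup.Normal.conj_mem inferInstance _ n.2 σ
  let x : inertiaIn N v := ⟨⟨σ * (n : absoluteGaloisGroup K) * σ⁻¹, inertia_le_decomp v hσ⟩, (mem_inertiaIn_iff N v _).2 ⟨hN, hσ⟩⟩
  have hx : inertiaInToH N v x = ⟨σ * (n : absoluteGaloisGroup K) * σ⁻¹, hN⟩ := rfl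
  have h0 := hunr x
  rw [hx, apply_conj_eq_smul_of_invariant z hinv σ n] at h0
  exact (smul_eq_zero_iff_eq σ).1 h0

/-- An invariant `z` killing `N ⊓ D_𝔭` (`decompIn N 𝔭`) kills every `n ∈ N` having a conjugate `σ n σ⁻¹ ∈ D_𝔭`.
[cite: NeukirchANT1999, Ch. I §9 (9.4)] -/
theorem apply_eq_zero_of_conj_mem_decomp (z : contOneCocycles (discreteTopRep N M))
    (hinv : ∀ (g : absoluteGaloisGroup K) (n : N), g • z.1 (subgroupConj N g n) = z.1 n)
    {v : HeightOneSpectrum (𝓞 K)} (hstr : ∀ x : decompIn N v, z.1 (decompInToH N v x) = 0)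
    {σ : absoluteGaloisGroup K} (n : N) (hσ : σ * (n : absoluteGaloisGroup K) * σ⁻¹ ∈ decomp (K := K) v) : z.1 n = 0 := by
  have hN : σ * (n : absoluteGaloisGroup K) * σ⁻¹ ∈ N := Subgroup.Normal.conj_mem inferInstance _ n.2 σ
  let x : decompIn N v := ⟨⟨σ * (n : absoluteGaloisGroup K) * σ⁻¹, hσ⟩, (mem_decompIn_iff N v _).2 hN⟩
  have hx : decompInToH N v x = ⟨σ * (n : absoluteGaloisGroup K) * σ⁻¹, hN⟩ := rfl
  have h0 := hstr x
  rw [hx, apply_conj_eq_smul_of_invariant z hinv σ n] at h0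
  exact (smul_eq_zero_iff_eq σ).1 h0

/-- Hence an invariant `z` killing `N ⊓ I_v` kills `N ∩ I_𝔓` for EVERY prime `𝔓` of `\bar ℤ_K` above `v` (p651053's dictionary
`forall_primesAbove_inertia_of_forall_conj`). [cite: NeukirchANT1999, Ch. I §9 Prop. (9.1)] [cite: NeukirchANT1999, Ch. II §9 Prop. (9.6)] -/
theorem apply_eq_zero_of_mem_primesAbove_inertia (z : contOneCocycles (discreteTopRep N M))
    (hinv : ∀ (g : absoluteGaloisGroup K) (n : N), g • z.1 (subgroupConj N g n) = z.1 n)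
    {v : HeightOneSpectrum (𝓞 K)} (hunr : ∀ x : inertiaIn N v, z.1 (inertiaInToH N v x) = 0)
    {𝔓 : Ideal (absIntegers (𝓞 K) K)} (h𝔓 : 𝔓 ∈ v.primesAbove) (n : N)
    (hn : (n : absoluteGaloisGroup K) ∈ 𝔓.inertia (absoluteGaloisGroup K)) : z.1 n = 0 :=
  forall_primesAbove_inertia_of_forall_conj (v := v)
    (fun m ↦ ∀ hm : m ∈ N, z.1 ⟨m, hm⟩ = 0)
    (fun _ m hσ hm ↦ apply_eq_zero_of_conj_mem_inertia z hinv hunr ⟨m, hm⟩ hσ) h𝔓 hn n.2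

/-- … and an invariant `z` killing `N ⊓ D_𝔭` kills `N ∩ D_𝔓` for every `𝔓` above `𝔭`. [cite: NeukirchANT1999, Ch. I §9 Prop. (9.1)]
[cite: NeukirchANT1999, Ch. II §9 Prop. (9.6)] -/
theorem apply_eq_zero_of_mem_primesAbove_decompositionSubgroup (z : contOneCocycles (discreteTopRep N M))
    (hinv : ∀ (g : absoluteGaloisGroup K) (n : N), g • z.1 (subgroupConj N g n) = z.1 n)
    {v : HeightOneSpectrum (𝓞 K)} (hstr : ∀ x : decompIn N v, z.1 (decompInToH N v x) = 0)
    {𝔓 : Ideal (absIntegers (𝓞 K) K)} (h𝔓 : 𝔓 ∈ v.primesAbove) (n : N)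
    (hn : (n : absoluteGaloisGroup K) ∈ 𝔓.decompositionSubgroup (absoluteGaloisGroup K)) : z.1 n = 0 :=
  forall_primesAbove_decompositionSubgroup_of_forall_conj (v := v)
    (fun m ↦ ∀ hm : m ∈ N, z.1 ⟨m, hm⟩ = 0)
    (fun _ m hσ hm ↦ apply_eq_zero_of_conj_mem_decomp z hinv hstr ⟨m, hm⟩ hσ) h𝔓 hn n.2

end Invariant

/-! ## §2 The LEAD's cocycle statement from the character statement over `L` -/

section Field

variable {K : Type} [Field K] [NumberField K] {p : ℕ} [hp : Fact p.Prime]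
variable {M : Type} [AddCommGroup M] [DistribMulAction (absoluteGaloisGroup K) M] [TopologicalSpace M] [DiscreteTopology M]
variable {L : Type} [Field L] [NumberField L] [Algebra K L]

/-- **The v11 Hom statement ⟸ the character statement over `L`.** Let `M` have prime order `p` with character `θ`
(`g • m = θ(g) • m`, `θ g = 1 ↔ g` acts trivially), `N = ker(Γ_K → Aut M)`, and `L/K` a number field with `res(Γ_L) = ker θ`. If every
continuous homomorphism `φ : Γ_L → ℤ/p`, `θ`-equivariant along `res`, killing `I_𝔔 ≤ Γ_L` for all primes `𝔔` of `\bar ℤ_L` above the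
places of `L` over `v ∉ S₀` (`v ∤ p`) and `D_𝔔` above the places over `𝔭`, vanishes — then every continuous `Γ_K`-invariant cocycle
`z : N → M` killing `N ⊓ I_v` (`v ∉ S₀`, `v ∤ p`) and `N ⊓ D_𝔭` vanishes (the hypothesis of `HerbrandUntwist.stubH_of_forall_hom_of_cmRamified`).
[cite: GreenbergLNM1716, §3 (PDF p. 86)] [cite: NeukirchANT1999, Ch. I §9 (9.4)–(9.6)] [cite: NeukirchANT1999, Ch. IV §1] -/
theorem forall_cocycle_ker_eq_zero_of_forall_hom_field (hcard : Nat.card M = p)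
    (θ : absoluteGaloisGroup K →* (ZMod p)ˣ)
    (hθ : ∀ (g : absoluteGaloisGroup K) (m : M), g • m = (((θ g : ZMod p).val : ℕ) : ℤ) • m)
    (hker : ∀ g : absoluteGaloisGroup K, θ g = 1 ↔ ∀ m : M, g • m = m)
    (hL : ∀ g : absoluteGaloisGroup K, g ∈ (absGaloisRestrict K L).range ↔ θ g = 1)
    (𝔭 : HeightOneSpectrum (𝓞 K)) (S₀ : Set (HeightOneSpectrum (𝓞 K)))
    (hhom : ∀ φ : absoluteGaloisGroup L → ZMod p, Continuous φ →
      (∀ a b : absoluteGaloisGroup L, φ (a * b) = φ a + φ b) →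
      (∀ (σ : absoluteGaloisGroup K) (τ τ' : absoluteGaloisGroup L),
        absGaloisRestrict K L τ' = σ * absGaloisRestrict K L τ * σ⁻¹ → φ τ' = (θ σ : ZMod p) * φ τ) →
      (∀ v : HeightOneSpectrum (𝓞 K), v ∉ S₀ → ((p : ℕ) : 𝓞 K) ∉ v.asIdeal →
        ∀ u : HeightOneSpectrum (𝓞 L), u.asIdeal.under (𝓞 K) = v.asIdeal →
          ∀ 𝔔 ∈ u.primesAbove, ∀ τ ∈ 𝔔.inertia (absoluteGaloisGroup L), φ τ = 0) →
      (∀ u : HeightOneSpectrum (𝓞 L), u.asIdeal.under (𝓞 K) = 𝔭.asIdeal →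
          ∀ 𝔔 ∈ u.primesAbove, ∀ τ ∈ 𝔔.decompositionSubgroup (absoluteGaloisGroup L), φ τ = 0) →
      ∀ τ : absoluteGaloisGroup L, φ τ = 0)
    (z : contOneCocycles (discreteTopRep (MulAction.toPermHom (absoluteGaloisGroup K) M).ker M))
    (hinv : ∀ (g : absoluteGaloisGroup K) (n : (MulAction.toPermHom (absoluteGaloisGroup K) M).ker),
      g • z.1 (subgroupConj _ g n) = z.1 n)
    (hunr : ∀ v : HeightOneSpectrum (𝓞 K), v ∉ S₀ → ((p : ℕ) : 𝓞 K) ∉ v.asIdeal →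
      ∀ x : inertiaIn (MulAction.toPermHom (absoluteGaloisGroup K) M).ker v, z.1 (inertiaInToH _ v x) = 0)
    (hstr : ∀ x : decompIn (MulAction.toPermHom (absoluteGaloisGroup K) M).ker 𝔭, z.1 (decompInToH _ 𝔭 x) = 0)
    (n : (MulAction.toPermHom (absoluteGaloisGroup K) M).ker) : z.1 n = 0 := by
  -- `res τ ∈ N` for every `τ ∈ Γ_L`
  have hresN : ∀ τ : absoluteGaloisGroup L,
      absGaloisRestrict K L τ ∈ (MulAction.toPermHom (absoluteGaloisGroup K) M).ker := fun τ ↦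
    (mem_ker_toPermHom_iff' (M := M) _).2 ((hker _).1 ((hL _).1 ⟨τ, rfl⟩))
  -- `N` acts trivially, so `z` is additive
  have htriv : ∀ (m : (MulAction.toPermHom (absoluteGaloisGroup K) M).ker) (x : M), m • x = x := fun m x ↦
    (mem_ker_toPermHom_iff' (M := M) (m : absoluteGaloisGroup K)).1 m.2 x
  -- transport along `M ≃+ ℤ/p`
  haveI : IsAddCyclic M := isAddCyclic_of_prime_card hcard
  let e : M ≃+ ZMod p := addEquivOfAddCyclicCardEq (by rw [hcard, Nat.card_zmod])
  -- the character `φ = e ∘ z ∘ res`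
  let φ : absoluteGaloisGroup L → ZMod p := fun τ ↦ e (z.1 ⟨absGaloisRestrict K L τ, hresN τ⟩)
  have hφc : Continuous φ :=
    continuous_of_discreteTopology.comp (z.1.continuous.comp ((absGaloisRestrict K L).continuous.subtype_mk _))
  have key := hhom φ hφc
    (fun a b ↦ by
      change e (z.1 ⟨_, _⟩) = e (z.1 ⟨_, _⟩) + e (z.1 ⟨_, _⟩)
      rw [← map_add]
      congr 1
      have hmul : (⟨absGaloisRestrict K L (a * b), hresN (a * b)⟩ : (MulAction.toPermHom (absoluteGaloisGroup K) M).ker) =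
          ⟨absGaloisRestrict K L a, hresN a⟩ * ⟨absGaloisRestrict K L b, hresN b⟩ := Subtype.ext (map_mul _ a b)
      rw [hmul, cocycle_map_mul_of_trivial htriv])
    (fun σ τ τ' h ↦ by
      change e (z.1 ⟨_, _⟩) = (θ σ : ZMod p) * e (z.1 ⟨_, _⟩)
      have hconj : (⟨absGaloisRestrict K L τ', hresN τ'⟩ : (MulAction.toPermHom (absoluteGaloisGroup K) M).ker) =
          ⟨σ * (absGaloisRestrict K L τ) * σ⁻¹, Subgroup.Normal.conj_mem inferInstance _ (hresN τ) σ⟩ := Subtype.ext h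
      rw [hconj, apply_conj_eq_smul_of_invariant z hinv σ ⟨absGaloisRestrict K L τ, hresN τ⟩, hθ σ, map_zsmul, zsmul_eq_mul,
        Int.cast_natCast, ZMod.natCast_zmod_val])
    (fun v hv hpv u hu 𝔔 h𝔔 τ hτ ↦ by
      change e (z.1 ⟨_, _⟩) = 0
      rw [apply_eq_zero_of_mem_primesAbove_inertia z hinv (hunr v hv hpv) (comap_absIntegersMap_mem_primesAbove hu h𝔔)
        ⟨absGaloisRestrict K L τ, hresN τ⟩ ((mem_inertia_iff_absGaloisRestrict_mem 𝔔 τ).1 hτ), map_zero])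
    (fun u hu 𝔔 h𝔔 τ hτ ↦ by
      change e (z.1 ⟨_, _⟩) = 0
      rw [apply_eq_zero_of_mem_primesAbove_decompositionSubgroup z hinv hstr (comap_absIntegersMap_mem_primesAbove hu h𝔔)
        ⟨absGaloisRestrict K L τ, hresN τ⟩ ((mem_decompositionSubgroup_iff_absGaloisRestrict_mem 𝔔 τ).1 hτ), map_zero])
  -- `n = res τ₀`
  have hn : θ (n : absoluteGaloisGroup K) = 1 := (hker _).2 ((mem_ker_toPermHom_iff' (M := M) _).1 n.2)
  obtain ⟨τ₀, hτ₀⟩ : (n : absoluteGaloisGroup K) ∈ (absGaloisRestrict K L).range := (hL _).2 hn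
  have hn' : n = ⟨absGaloisRestrict K L τ₀, hresN τ₀⟩ := Subtype.ext hτ₀.symm
  have h0 : e (z.1 n) = 0 := by rw [hn']; exact key τ₀
  exact e.map_eq_zero_iff.1 h0

end Field

/-! ## §3 On the class: the hypotheses of `HerbrandUntwist.stubH_of_forall_hom_of_cmRamified` from the character statements over `L`, `L'` -/

section Class

variable {p : ℕ} [hp : Fact p.Prime]

/-- **v11 Stub H, `Φ`-conjunct, over the number field `L = K(Φ)`.** For `W/ℚ` CM, `p ≥ 5` CM-ramified (only `#Φ = p` is used), `K` a
number field, a stable line `Φ ≤ W_K[p]` of order `p` with character `θ`, `L/K` with `res(Γ_L) = ker θ`, `𝔭`, `S`: the LEAD's Hom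
statement for `(N_θ, Φ)` follows from the character statement over `L`. [cite: GreenbergLNM1716, §3 (PDF p. 86)]
[cite: NeukirchANT1999, Ch. IV §1] -/
theorem homVanishing_sub_of_forall_hom_field (W : WeierstrassCurve ℚ) (K : Type) [Field K] [NumberField K]
    (𝔭 : HeightOneSpectrum (𝓞 K)) (S : Set (HeightOneSpectrum (𝓞 K)))
    (Φ : X2.ResidualDevissageModules.StableSubgroup (absoluteGaloisGroup K) ((W.baseChange K).geomTorsion (p : ℤ)))
    (hcard : Nat.card Φ.Sub = p) (θ : absoluteGaloisGroup K →* (ZMod p)ˣ)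
    (hθ : ∀ (g : absoluteGaloisGroup K) (x : Φ.Sub), g • x = (((θ g : ZMod p).val : ℕ) : ℤ) • x)
    (hker : ∀ g : absoluteGaloisGroup K, θ g = 1 ↔ ∀ x : Φ.Sub, g • x = x)
    (L : Type) [Field L] [NumberField L] [Algebra K L]
    (hL : ∀ g : absoluteGaloisGroup K, g ∈ (absGaloisRestrict K L).range ↔ θ g = 1)
    (hhom : ∀ φ : absoluteGaloisGroup L → ZMod p, Continuous φ →
      (∀ a b : absoluteGaloisGroup L, φ (a * b) = φ a + φ b) →
      (∀ (σ : absoluteGaloisGroup K) (τ τ' : absoluteGaloisGroup L),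
        absGaloisRestrict K L τ' = σ * absGaloisRestrict K L τ * σ⁻¹ → φ τ' = (θ σ : ZMod p) * φ τ) →
      (∀ v : HeightOneSpectrum (𝓞 K), v ∉ S → ((p : ℕ) : 𝓞 K) ∉ v.asIdeal →
        ∀ u : HeightOneSpectrum (𝓞 L), u.asIdeal.under (𝓞 K) = v.asIdeal →
          ∀ 𝔔 ∈ u.primesAbove, ∀ τ ∈ 𝔔.inertia (absoluteGaloisGroup L), φ τ = 0) →
      (∀ u : HeightOneSpectrum (𝓞 L), u.asIdeal.under (𝓞 K) = 𝔭.asIdeal →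
          ∀ 𝔔 ∈ u.primesAbove, ∀ τ ∈ 𝔔.decompositionSubgroup (absoluteGaloisGroup L), φ τ = 0) →
      ∀ τ : absoluteGaloisGroup L, φ τ = 0) :
    ∀ z : contOneCocycles (discreteTopRep (MulAction.toPermHom (absoluteGaloisGroup K) Φ.Sub).ker Φ.Sub),
      (∀ (g : absoluteGaloisGroup K) (n : (MulAction.toPermHom (absoluteGaloisGroup K) Φ.Sub).ker),
        g • z.1 (subgroupConj _ g n) = z.1 n) →
      (∀ v : HeightOneSpectrum (𝓞 K), v ∉ S → ((p : ℕ) : 𝓞 K) ∉ v.asIdeal →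
        ∀ x : inertiaIn (MulAction.toPermHom (absoluteGaloisGroup K) Φ.Sub).ker v, z.1 (inertiaInToH _ v x) = 0) →
      (∀ x : decompIn (MulAction.toPermHom (absoluteGaloisGroup K) Φ.Sub).ker 𝔭, z.1 (decompInToH _ 𝔭 x) = 0) →
      ∀ n, z.1 n = 0 :=
  fun z hinv hunr hstr n ↦
    forall_cocycle_ker_eq_zero_of_forall_hom_field hcard θ hθ hker hL 𝔭 S hhom z hinv hunr hstr n

/-- **v11 Stub H, `W[p]/Φ`-conjunct, over `L' = K(W[p]/Φ)`** (`res(Γ_{L'}) = ker θ'`; on the class `#(W[p]/Φ) = p` from `#Φ = p`,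
`HerbrandLineRestriction.natCard_quot_eq_of_card_sub`). [cite: GreenbergLNM1716, §3 (PDF p. 86)] [cite: NeukirchANT1999, Ch. IV §1] -/
theorem homVanishing_quot_of_forall_hom_field (W : WeierstrassCurve ℚ) (K : Type) [Field K] [NumberField K]
    [(W.baseChange K).IsElliptic] (𝔭 : HeightOneSpectrum (𝓞 K)) (S : Set (HeightOneSpectrum (𝓞 K)))
    (Φ : X2.ResidualDevissageModules.StableSubgroup (absoluteGaloisGroup K) ((W.baseChange K).geomTorsion (p : ℤ)))
    (hcard : Nat.card Φ.Sub = p) (θ' : absoluteGaloisGroup K →* (ZMod p)ˣ)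
    (hθ' : ∀ (g : absoluteGaloisGroup K) (y : Φ.Quot), g • y = (((θ' g : ZMod p).val : ℕ) : ℤ) • y)
    (hker' : ∀ g : absoluteGaloisGroup K, θ' g = 1 ↔ ∀ y : Φ.Quot, g • y = y)
    (L' : Type) [Field L'] [NumberField L'] [Algebra K L']
    (hL' : ∀ g : absoluteGaloisGroup K, g ∈ (absGaloisRestrict K L').range ↔ θ' g = 1)
    (hhom : ∀ φ : absoluteGaloisGroup L' → ZMod p, Continuous φ →
      (∀ a b : absoluteGaloisGroup L', φ (a * b) = φ a + φ b) →
      (∀ (σ : absoluteGaloisGroup K) (τ τ' : absoluteGaloisGroup L'),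
        absGaloisRestrict K L' τ' = σ * absGaloisRestrict K L' τ * σ⁻¹ → φ τ' = (θ' σ : ZMod p) * φ τ) →
      (∀ v : HeightOneSpectrum (𝓞 K), v ∉ S → ((p : ℕ) : 𝓞 K) ∉ v.asIdeal →
        ∀ u : HeightOneSpectrum (𝓞 L'), u.asIdeal.under (𝓞 K) = v.asIdeal →
          ∀ 𝔔 ∈ u.primesAbove, ∀ τ ∈ 𝔔.inertia (absoluteGaloisGroup L'), φ τ = 0) →
      (∀ u : HeightOneSpectrum (𝓞 L'), u.asIdeal.under (𝓞 K) = 𝔭.asIdeal →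
          ∀ 𝔔 ∈ u.primesAbove, ∀ τ ∈ 𝔔.decompositionSubgroup (absoluteGaloisGroup L'), φ τ = 0) →
      ∀ τ : absoluteGaloisGroup L', φ τ = 0) :
    ∀ z : contOneCocycles (discreteTopRep (MulAction.toPermHom (absoluteGaloisGroup K) Φ.Quot).ker Φ.Quot),
      (∀ (g : absoluteGaloisGroup K) (n : (MulAction.toPermHom (absoluteGaloisGroup K) Φ.Quot).ker),
        g • z.1 (subgroupConj _ g n) = z.1 n) →
      (∀ v : HeightOneSpectrum (𝓞 K), v ∉ S → ((p : ℕ) : 𝓞 K) ∉ v.asIdeal →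
        ∀ x : inertiaIn (MulAction.toPermHom (absoluteGaloisGroup K) Φ.Quot).ker v, z.1 (inertiaInToH _ v x) = 0) →
      (∀ x : decompIn (MulAction.toPermHom (absoluteGaloisGroup K) Φ.Quot).ker 𝔭, z.1 (decompInToH _ 𝔭 x) = 0) →
      ∀ n, z.1 n = 0 :=
  fun z hinv hunr hstr n ↦
    forall_cocycle_ker_eq_zero_of_forall_hom_field
      (HerbrandLineRestriction.natCard_quot_eq_of_card_sub (W.baseChange K) Φ hcard) θ' hθ' hker' hL' 𝔭 S hhom z hinv hunr hstr n

/-- **Stub H (v10's two conclusions) from the two character statements over the number fields `L = K(Φ)`, `L' = K(W[p]/Φ)`** —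
LEAD g8's `HerbrandUntwist.stubH_of_forall_hom_of_cmRamified` (p651343) fed with `homVanishing_sub_of_forall_hom_field` /
`homVanishing_quot_of_forall_hom_field`. What the T4 prover supplies: for each of `θ`, `θ'` a number field over `K` whose absolute
Galois group restricts onto the kernel (e.g. the fixed field, `range_absGaloisRestrict_fixedField_eq_of_normal`) and the vanishing of the
`θ`- (resp. `θ'`-) equivariant continuous characters `Γ_L → 𝔽_p` unramified above `v ∉ S`, `v ∤ p` and split above `𝔭` — Road A steps
A3–A6 + T5. [cite: GreenbergLNM1716, §3 (PDF p. 86)] [cite: KrizLi2019, p. 3 («relative p-class numbers»)] [cite: NeukirchANT1999, Ch. IV §1] -/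
theorem stubH_of_forall_hom_field (W : WeierstrassCurve ℚ) [W.IsElliptic] (hCM : W.HasCM)
    (hram : Rank1Residual.CMRamified W p) (h5 : 5 ≤ p) (K : Type) [Field K] [NumberField K] (hK2 : Module.finrank ℚ K = 2)
    (κ : ZpExtension K p) (𝔭 : HeightOneSpectrum (𝓞 K)) (h𝔭 : ((p : ℕ) : 𝓞 K) ∈ 𝔭.asIdeal)
    (S : Set (HeightOneSpectrum (𝓞 K)))
    (Φ : X2.ResidualDevissageModules.StableSubgroup (absoluteGaloisGroup K) ((W.baseChange K).geomTorsion (p : ℤ)))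
    (hcard : Nat.card Φ.Sub = p)
    (θ : absoluteGaloisGroup K →* (ZMod p)ˣ)
    (hθ : ∀ (g : absoluteGaloisGroup K) (x : Φ.Sub), g • x = (((θ g : ZMod p).val : ℕ) : ℤ) • x)
    (hker : ∀ g : absoluteGaloisGroup K, θ g = 1 ↔ ∀ x : Φ.Sub, g • x = x)
    (L : Type) [Field L] [NumberField L] [Algebra K L]
    (hL : ∀ g : absoluteGaloisGroup K, g ∈ (absGaloisRestrict K L).range ↔ θ g = 1)
    (hhomS : ∀ φ : absoluteGaloisGroup L → ZMod p, Continuous φ →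
      (∀ a b : absoluteGaloisGroup L, φ (a * b) = φ a + φ b) →
      (∀ (σ : absoluteGaloisGroup K) (τ τ' : absoluteGaloisGroup L),
        absGaloisRestrict K L τ' = σ * absGaloisRestrict K L τ * σ⁻¹ → φ τ' = (θ σ : ZMod p) * φ τ) →
      (∀ v : HeightOneSpectrum (𝓞 K), v ∉ S → ((p : ℕ) : 𝓞 K) ∉ v.asIdeal →
        ∀ u : HeightOneSpectrum (𝓞 L), u.asIdeal.under (𝓞 K) = v.asIdeal →
          ∀ 𝔔 ∈ u.primesAbove, ∀ τ ∈ 𝔔.inertia (absoluteGaloisGroup L), φ τ = 0) →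
      (∀ u : HeightOneSpectrum (𝓞 L), u.asIdeal.under (𝓞 K) = 𝔭.asIdeal →
          ∀ 𝔔 ∈ u.primesAbove, ∀ τ ∈ 𝔔.decompositionSubgroup (absoluteGaloisGroup L), φ τ = 0) →
      ∀ τ : absoluteGaloisGroup L, φ τ = 0)
    (θ' : absoluteGaloisGroup K →* (ZMod p)ˣ)
    (hθ' : ∀ (g : absoluteGaloisGroup K) (y : Φ.Quot), g • y = (((θ' g : ZMod p).val : ℕ) : ℤ) • y)
    (hker' : ∀ g : absoluteGaloisGroup K, θ' g = 1 ↔ ∀ y : Φ.Quot, g • y = y)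
    (L' : Type) [Field L'] [NumberField L'] [Algebra K L']
    (hL' : ∀ g : absoluteGaloisGroup K, g ∈ (absGaloisRestrict K L').range ↔ θ' g = 1)
    (hhomQ : ∀ φ : absoluteGaloisGroup L' → ZMod p, Continuous φ →
      (∀ a b : absoluteGaloisGroup L', φ (a * b) = φ a + φ b) →
      (∀ (σ : absoluteGaloisGroup K) (τ τ' : absoluteGaloisGroup L'),
        absGaloisRestrict K L' τ' = σ * absGaloisRestrict K L' τ * σ⁻¹ → φ τ' = (θ' σ : ZMod p) * φ τ) →
      (∀ v : HeightOneSpectrum (𝓞 K), v ∉ S → ((p : ℕ) : 𝓞 K) ∉ v.asIdeal →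
        ∀ u : HeightOneSpectrum (𝓞 L'), u.asIdeal.under (𝓞 K) = v.asIdeal →
          ∀ 𝔔 ∈ u.primesAbove, ∀ τ ∈ 𝔔.inertia (absoluteGaloisGroup L'), φ τ = 0) →
      (∀ u : HeightOneSpectrum (𝓞 L'), u.asIdeal.under (𝓞 K) = 𝔭.asIdeal →
          ∀ 𝔔 ∈ u.primesAbove, ∀ τ ∈ 𝔔.decompositionSubgroup (absoluteGaloisGroup L'), φ τ = 0) →
      ∀ τ : absoluteGaloisGroup L', φ τ = 0) :
    datumStrictSelmer (κ.layerSubgroup 0) Φ.Sub p (AcSelmer.bdpData Φ.Sub p 𝔭) S = ⊥ ∧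
      datumStrictSelmer (κ.layerSubgroup 0) Φ.Quot p (AcSelmer.bdpData Φ.Quot p 𝔭) S = ⊥ := by
  haveI hE : (W.baseChange K).IsElliptic := by unfold WeierstrassCurve.baseChange; infer_instance
  exact HerbrandUntwist.stubH_of_forall_hom_of_cmRamified W hCM hram h5 K hK2 κ 𝔭 h𝔭 S Φ hcard
    (homVanishing_sub_of_forall_hom_field W K 𝔭 S Φ hcard θ hθ hker L hL hhomS)
    (homVanishing_quot_of_forall_hom_field W K 𝔭 S Φ hcard θ' hθ' hker' L' hL' hhomQ)

end Class

end Summit.BirchSwinnertonDyer.BirchSwinnertonDyer.Theorems.PrintCFram.HerbrandSelmerToHom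

end
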